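import Summits.NavierStokesRegularity.OSWSelfSimilar.SheetNSLineSchochetTwoPoleReadouts
import HarnessLib

/-!
# The blow-up PROFILE of the Schochet–ALSS solution is the Schochet corner of the NS-type line

HONEST FRAMING (cell ns-blowup GROUP B «PROFILE SEARCH», zone Z3, rows Z3-E12⁻ (clause (i′): «the Schochet corner a = 0 is the
divide», kernel row p464720 `SheetNSLineSchochetCorner.corner_profile_explicit`) and Z3-U (A-F2) of `HOME/profile/z3/CENSUS-Z3.md`;
human rulings D-0035/D-0074): **1-D MODEL (viscous CLM `ω_t = ω·Hω + ν ω_xx` on `ℝ`); not Euler, not Navier–Stokes;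
«violates: none — MODEL».**

THE THEOREM (`tendsto_selfsimilar_profile`). For the two-pole solution family of `SheetNSLineSchochetTwoPoleSolution.lean`
(separation `s(t) = √(s₀² + 40kνt)`, upper depth `y = (σ − s)/2`, blow-up time `T = (σ² − s₀²)/(40kν)`), at EVERY similarity
abscissa `ξ`:

  `(T − t)² · ω(t, (T − t)·ξ) ⟶ −24ν ṽ ξ/(ξ² + ṽ²)²`  as `t ↑ T`,  `ṽ = 10kν/σ`,

i.e. in the parabolic-gauge-free similarity variables `(C_ω, C_l) = ((T−t)^{−2}, T−t)` the solution converges pointwise to the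
DILATED DOUBLE POLE `Ω_ℓ(η) = −24νℓ·η/(η² + ℓ²)²`, `ℓ = ṽ` — exactly the Schochet corner profile `corner_profile_explicit` (`ε = ν`)
of the sheet's NS-type line (`c_l/c_ω = 1/2`). [cite: AmbroseLushnikovSiegelSilantyev2024, §5.1.1 (self-similar form of
Schochet's solution: `ω ≃ −24ṽ (t_c − t)^{−2} ξ/(ξ²+ṽ²)²`, `ṽ = −(5i/12)K_±ν/(x₁(0)+x₂(0))` = `10kν/σ` here)]. Ingredient:
the exact depth law `y(t) = 20kν(T − t)/(σ + s(t))` (`depth_eq`), after which `(T−t)²ω(t,(T−t)ξ)` is an explicit continuous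
function of `(T − t, s(t))` whose value at `(0, σ)` is the corner profile. So the census's dynamic statement (small-data blow-up on
`ℝ`, `SheetNSLineSchochetTwoPoleBlowup`) and its static one (the corner is the unique double-pole point of the NS-type line,
`SheetNSLineSchochetCorner`) are ONE object in the kernel. WHAT IS NOT HERE: uniform-in-`ξ` convergence or rates; stability of the
profile; anything about Navier–Stokes. No definitions, no named facts. bears_on: LADDER-NS N5 / zone Z3 → N1 linear core.
-/

noncomputable section

namespace Summit.NavierStokesRegularity.OSWSelfSimilar
namespace SheetNSLineSchochetTwoPole

open _root_.MeasureTheory Set Filter Literature.Analysis.Fourier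
open scoped Real Topology

section Profile

variable {ν k σ s₀ : ℝ} {s y : ℝ → ℝ} {ω : ℝ → ℝ → ℝ}

/-- **Exact depth law:** `y(t) = 20kν(T − t)/(σ + s(t))` on `0 ≤ t` (`T = (σ² − s₀²)/(40kν)`), from `σ² − s(t)² = 40kν(T − t)`.
[folklore] -/
theorem depth_eq (hν : 0 < ν) (hk0 : 0 < k) (hs₀ : 0 < s₀) (hs₀σ : s₀ < σ)
    (hs : ∀ t, s t = Real.sqrt (s₀ ^ 2 + 40 * k * ν * t)) (hy : ∀ t, y t = (σ - s t) / 2) {t : ℝ} (ht0 : 0 ≤ t) :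
    y t = 20 * k * ν * ((σ ^ 2 - s₀ ^ 2) / (40 * k * ν) - t) / (σ + s t) := by
  have hσ : 0 < σ := hs₀.trans hs₀σ
  have h40 : (40 * k * ν) ≠ 0 := by positivity
  have hrad : 0 ≤ s₀ ^ 2 + 40 * k * ν * t := by positivity
  have hs2 : s t ^ 2 = s₀ ^ 2 + 40 * k * ν * t := by rw [hs]; exact Real.sq_sqrt hrad
  have hspos : 0 ≤ s t := by rw [hs]; exact Real.sqrt_nonneg _
  have hsum : 0 < σ + s t := by linarith
  rw [eq_div_iff hsum.ne', hy]
  field_simp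
  nlinarith [hs2]

/-- **The blow-up profile is the Schochet corner.** `(T−t)²·ω(t,(T−t)ξ) → −24νṽξ/(ξ²+ṽ²)²`, `ṽ = 10kν/σ`, as `t ↑ T`, at every `ξ`.
[cite: AmbroseLushnikovSiegelSilantyev2024, §5.1.1 (self-similar form of Schochet's solution)] -/
theorem tendsto_selfsimilar_profile (hν : 0 < ν) (hk0 : 0 < k) (hs₀ : 0 < s₀) (hs₀σ : s₀ < σ)
    (hs : ∀ t, s t = Real.sqrt (s₀ ^ 2 + 40 * k * ν * t)) (hy : ∀ t, y t = (σ - s t) / 2)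
    (hω : ∀ t x, ω t x = (-24 * k * ν / s t) * (x / (x ^ 2 + y t ^ 2) - x / (x ^ 2 + (y t + s t) ^ 2))
      + (-12 * ν) * (2 * y t * x / (x ^ 2 + y t ^ 2) ^ 2 + 2 * (y t + s t) * x / (x ^ 2 + (y t + s t) ^ 2) ^ 2))
    (ξ : ℝ) :
    Tendsto (fun t => ((σ ^ 2 - s₀ ^ 2) / (40 * k * ν) - t) ^ 2 * ω t (((σ ^ 2 - s₀ ^ 2) / (40 * k * ν) - t) * ξ))
      (𝓝[<] ((σ ^ 2 - s₀ ^ 2) / (40 * k * ν)))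
      (𝓝 (-24 * ν * (10 * k * ν / σ) * ξ / (ξ ^ 2 + (10 * k * ν / σ) ^ 2) ^ 2)) := by
  have hσ : 0 < σ := hs₀.trans hs₀σ
  set T := (σ ^ 2 - s₀ ^ 2) / (40 * k * ν) with hT
  have hT0 : 0 < T := blowupTime_pos hν hk0 hs₀ hs₀σ
  -- `s` is continuous with `s(T) = σ`
  have hsc : Continuous s := by
    obtain rfl : s = fun t => Real.sqrt (s₀ ^ 2 + 40 * k * ν * t) := funext hs
    fun_prop
  have hsT : s T = σ := by
    have h40 : 40 * k * ν ≠ 0 := by positivity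
    have hrad : s₀ ^ 2 + 40 * k * ν * T = σ ^ 2 := by rw [hT]; field_simp; ring
    rw [hs, hrad, Real.sqrt_sq hσ.le]
  have hS : Tendsto s (𝓝[<] T) (𝓝 σ) := by
    have := (hsc.tendsto T).mono_left (nhdsWithin_le_nhds (s := Iio T))
    rwa [hsT] at this
  have hid : Tendsto (fun t : ℝ => t) (𝓝[<] T) (𝓝 T) :=
    (continuous_id.tendsto T).mono_left (nhdsWithin_le_nhds (s := Iio T))
  have hτ : Tendsto (fun t => T - t) (𝓝[<] T) (𝓝 0) := by
    simpa using (tendsto_const_nhds (x := T)).sub hid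
  -- the structural pieces
  have hσ2 : σ + σ ≠ 0 := by positivity
  have hr : Tendsto (fun t => 20 * k * ν / (σ + s t)) (𝓝[<] T) (𝓝 (20 * k * ν / (σ + σ))) :=
    tendsto_const_nhds.div (tendsto_const_nhds.add hS) hσ2
  have hA : Tendsto (fun t => -24 * k * ν / s t) (𝓝[<] T) (𝓝 (-24 * k * ν / σ)) :=
    tendsto_const_nhds.div hS hσ.ne'
  have hv0 : 0 < 20 * k * ν / (σ + σ) := by positivity
  have hden1 : ξ ^ 2 + (20 * k * ν / (σ + σ)) ^ 2 ≠ 0 := by positivity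
  -- y₂ = r (T - t) + s t → σ
  have hy2 : Tendsto (fun t => 20 * k * ν / (σ + s t) * (T - t) + s t) (𝓝[<] T) (𝓝 (20 * k * ν / (σ + σ) * 0 + σ)) :=
    (hr.mul hτ).add hS
  have hden2 : (0 * ξ) ^ 2 + (20 * k * ν / (σ + σ) * 0 + σ) ^ 2 ≠ 0 := by
    have : 20 * k * ν / (σ + σ) * 0 + σ = σ := by ring
    rw [this]; positivity
  -- the four terms of `(T−t)² ω(t,(T−t)ξ)` as functions of `(T − t, s t)`
  have h1 : Tendsto (fun t => (-24 * k * ν / s t) * (T - t) * ξ / (ξ ^ 2 + (20 * k * ν / (σ + s t)) ^ 2)) (𝓝[<] T)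
      (𝓝 ((-24 * k * ν / σ) * 0 * ξ / (ξ ^ 2 + (20 * k * ν / (σ + σ)) ^ 2))) :=
    (((hA.mul hτ).mul tendsto_const_nhds).div (tendsto_const_nhds.add (hr.pow 2)) hden1)
  have h2 : Tendsto (fun t => (-24 * k * ν / s t) * (T - t) ^ 3 * ξ
        / (((T - t) * ξ) ^ 2 + (20 * k * ν / (σ + s t) * (T - t) + s t) ^ 2)) (𝓝[<] T)
      (𝓝 ((-24 * k * ν / σ) * 0 ^ 3 * ξ / ((0 * ξ) ^ 2 + (20 * k * ν / (σ + σ) * 0 + σ) ^ 2))) :=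
    (((hA.mul (hτ.pow 3)).mul tendsto_const_nhds).div (((hτ.mul tendsto_const_nhds).pow 2).add (hy2.pow 2)) hden2)
  have h3 : Tendsto (fun t => 24 * ν * (20 * k * ν / (σ + s t)) * ξ / (ξ ^ 2 + (20 * k * ν / (σ + s t)) ^ 2) ^ 2) (𝓝[<] T)
      (𝓝 (24 * ν * (20 * k * ν / (σ + σ)) * ξ / (ξ ^ 2 + (20 * k * ν / (σ + σ)) ^ 2) ^ 2)) :=
    (((tendsto_const_nhds.mul hr).mul tendsto_const_nhds).div ((tendsto_const_nhds.add (hr.pow 2)).pow 2)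
      (pow_ne_zero 2 hden1))
  have h4 : Tendsto (fun t => 24 * ν * (20 * k * ν / (σ + s t) * (T - t) + s t) * (T - t) ^ 3 * ξ
        / (((T - t) * ξ) ^ 2 + (20 * k * ν / (σ + s t) * (T - t) + s t) ^ 2) ^ 2) (𝓝[<] T)
      (𝓝 (24 * ν * (20 * k * ν / (σ + σ) * 0 + σ) * 0 ^ 3 * ξ
        / ((0 * ξ) ^ 2 + (20 * k * ν / (σ + σ) * 0 + σ) ^ 2) ^ 2)) :=
    ((((tendsto_const_nhds.mul hy2).mul (hτ.pow 3)).mul tendsto_const_nhds).div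
      ((((hτ.mul tendsto_const_nhds).pow 2).add (hy2.pow 2)).pow 2) (pow_ne_zero 2 hden2))
  have hG := ((h1.sub h2).sub h3).sub h4
  -- the limit value is the corner profile
  have hlim : (-24 * k * ν / σ) * 0 * ξ / (ξ ^ 2 + (20 * k * ν / (σ + σ)) ^ 2)
      - (-24 * k * ν / σ) * 0 ^ 3 * ξ / ((0 * ξ) ^ 2 + (20 * k * ν / (σ + σ) * 0 + σ) ^ 2)
      - 24 * ν * (20 * k * ν / (σ + σ)) * ξ / (ξ ^ 2 + (20 * k * ν / (σ + σ)) ^ 2) ^ 2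
      - 24 * ν * (20 * k * ν / (σ + σ) * 0 + σ) * 0 ^ 3 * ξ / ((0 * ξ) ^ 2 + (20 * k * ν / (σ + σ) * 0 + σ) ^ 2) ^ 2
      = -24 * ν * (10 * k * ν / σ) * ξ / (ξ ^ 2 + (10 * k * ν / σ) ^ 2) ^ 2 := by
    have e : 20 * k * ν / (σ + σ) = 10 * k * ν / σ := by field_simp; ring
    rw [e]
    ring
  rw [hlim] at hG
  -- the solution coincides with this explicit function of `(T − t, s t)` on `(0, T)`
  refine hG.congr' ?_
  have hpos : ∀ᶠ t in 𝓝[<] T, 0 < t := (lt_mem_nhds hT0).filter_mono nhdsWithin_le_nhds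
  filter_upwards [hpos, self_mem_nhdsWithin] with t ht0 htT
  have htT' : t < T := htT
  have hτ0 : T - t ≠ 0 := by linarith
  have hst : 0 < s t := sep_pos hs (radicand_pos hν hk0 hs₀ ht0.le)
  have hyt : 0 < y t := depth_pos hν hk0 hσ hs hy htT'
  have hsum : 0 < σ + s t := by linarith
  have hyeq : y t = 20 * k * ν / (σ + s t) * (T - t) := by
    rw [depth_eq hν hk0 hs₀ hs₀σ hs hy ht0.le]
    ring
  have hr0 : 0 < 20 * k * ν / (σ + s t) := by positivity
  have hd1 : ξ ^ 2 + (20 * k * ν / (σ + s t)) ^ 2 ≠ 0 := by positivity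
  have hy2pos : 0 < 20 * k * ν / (σ + s t) * (T - t) + s t := by rw [← hyeq]; linarith
  have hd2 : ((T - t) * ξ) ^ 2 + (20 * k * ν / (σ + s t) * (T - t) + s t) ^ 2 ≠ 0 := by positivity
  rw [hω, hyeq]
  have hsne : s t ≠ 0 := hst.ne'
  have hd3 : ((T - t) * ξ) ^ 2 + (20 * k * ν / (σ + s t) * (T - t)) ^ 2
      = (T - t) ^ 2 * (ξ ^ 2 + (20 * k * ν / (σ + s t)) ^ 2) := by ring
  rw [hd3]
  field_simp
  ring

end Profile

end SheetNSLineSchochetTwoPole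
end Summit.NavierStokesRegularity.OSWSelfSimilar

end
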